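import Summits.QuantumAdvantage.QuantumAdvantage.Theorems.LinnikCubicClassGroupsDegreeOnePrimesEscapeFrobeniusWindowSmoothed
import HarnessLib

/-!
# The Chebotarev prime number theorem in short intervals: unsmoothing by two windows

Topic `Summits/QuantumAdvantage/QuantumAdvantage/Theorems`, cell B2b-1 (linnik-cubic), PART A (gen 17); helper
toward the crux `DegreeOnePrimesEscape` (stmt-QuantumAdvantage-11543) of route `LinnikCubicClassGroups` — the
CHEBOTAREV DENSITY THEOREM IN SHORT INTERVALS for conjugacy classes.  HONEST FRAMING: the value of this file is a
THEOREM (kernel-checked lemmas) — NOT summit progress.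

Elementary input of `…FrobeniusWindowPsi.lean`: for weighted prime-power sums `ψ_w(y) = Σ_{N𝔞 ≤ y} w(𝔞)Λ(𝔞)`
(`0 ≤ w ≤ 1`) and the window weights `windowTest` of `Literature/…/WindowWeight.lean`,
* unsmoothing by monotonicity (`smoothedPsiWeighted_le_psiWeighted_sub`, `psiWeighted_sub_le_smoothedPsiWeighted`);
* collar numerics: `(e^{σv} − e^{σu})/σ ≤ (v − u)e^{v}` (`0 < σ ≤ 1`, `0 ≤ u ≤ v`), the closed form
  `∫_a^b e^{σu} du = (e^{σb} − e^{σa})/σ`, and the outer/inner collar bounds `≤ 2ε e^{b+ε}`, `≤ 2ε e^{b}`;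
* `window_sandwich` — the two-window sandwich: two-sided smoothed estimates for the windows `[log x, log(x+h)]`
  and `[log x + ε, log(x+h) − ε]` (`ε = ε₀ log(1 + h/x)`) give `m(ψ_w(x+h) − ψ_w(x))` within `κh + 24ε₀h + J` of
  `h − r (((x+h)^σ − x^σ)/σ)`.
References: G. Hoheisel (1930); A. Balog, K. Ono, J. Number Theory 91 (2001); S. Gun, S. L. Naik,
arXiv:2405.04698 (2024), Thm. 7.
-/

noncomputable section

open Complex Real Finset NumberField IsDedekindDomain
open scoped NumberField nonZeroDivisors Classical

namespace Summit.QuantumAdvantage.QuantumAdvantage.Theorems.DegreeOnePrimesEscape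

open Literature.NumberTheory.LFunctions Literature.NumberTheory.LFunctions.NumberField
  Literature.NumberTheory.LFunctions.EntireEF Literature.NumberTheory.LFunctions.WindowWeight
  Literature.NumberTheory.LFunctions.AbelianDensity Literature.NumberTheory.GaloisRepresentations

/-! ### Unsmoothing for weighted prime-power sums -/

section Unsmoothing

variable {K : Type} [Field K] [NumberField K] {w : Ideal (𝓞 K) → ℝ}

/-- `ψ_w(x+h) − ψ_w(x) = Σ_{⌊x⌋ < n ≤ ⌊x+h⌋} Λ_w(n)` (`h ≥ 0`). -/
theorem psiWeighted_sub_eq_sum (w : Ideal (𝓞 K) → ℝ) {x h : ℝ} (hh : 0 ≤ h) :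
    (∑ n ∈ Icc 0 ⌊x + h⌋₊, ∑ I ∈ idealsOfNorm K n, w I * idealVonMangoldt I) -
      (∑ n ∈ Icc 0 ⌊x⌋₊, ∑ I ∈ idealsOfNorm K n, w I * idealVonMangoldt I) =
      ∑ n ∈ Finset.Ioc ⌊x⌋₊ ⌊x + h⌋₊, ∑ I ∈ idealsOfNorm K n, w I * idealVonMangoldt I := by
  have hsub : Icc 0 ⌊x⌋₊ ⊆ Icc 0 ⌊x + h⌋₊ := Icc_subset_Icc le_rfl (Nat.floor_le_floor (by linarith))
  rw [← Finset.sum_sdiff hsub]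
  have hsd : Icc 0 ⌊x + h⌋₊ \ Icc 0 ⌊x⌋₊ = Finset.Ioc ⌊x⌋₊ ⌊x + h⌋₊ := by
    ext n; simp only [Finset.mem_sdiff, mem_Icc, Finset.mem_Ioc]; omega
  rw [hsd]; ring

/-- **Lower unsmoothing**: if `0 ≤ g ≤ 1`, `g(u) = 0` for `u ≤ log x` and for `u ≥ log(x+h)` (`x ≥ 1`, `h ≥ 0`,
`w ≥ 0`), then `ψ̃_w(g) ≤ ψ_w(x+h) − ψ_w(x)`. -/
theorem smoothedPsiWeighted_le_psiWeighted_sub (hw : ∀ I, 0 ≤ w I) {g : ℝ → ℝ} {x h : ℝ} (hx : 1 ≤ x)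
    (hh : 0 ≤ h) (hg01 : ∀ u, g u ∈ Set.Icc (0 : ℝ) 1) (hg0 : ∀ u, u ≤ Real.log x → g u = 0)
    (hg1 : ∀ u, Real.log (x + h) ≤ u → g u = 0) :
    (∑' n : ℕ, (∑ I ∈ idealsOfNorm K n, w I * idealVonMangoldt I) * g (Real.log n)) ≤
      (∑ n ∈ Icc 0 ⌊x + h⌋₊, ∑ I ∈ idealsOfNorm K n, w I * idealVonMangoldt I) -
        (∑ n ∈ Icc 0 ⌊x⌋₊, ∑ I ∈ idealsOfNorm K n, w I * idealVonMangoldt I) := by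
  set M : ℕ := ⌊x + h⌋₊ + 1 with hM
  have hM1 : 1 ≤ M := by omega
  have hxh : 0 < x + h := by linarith
  have hMlog : Real.log (x + h) ≤ Real.log M := by
    have h1 : x + h ≤ M := by rw [hM]; push_cast; exact (Nat.lt_floor_add_one _).le
    exact Real.log_le_log hxh h1
  rw [smoothedPsiWeighted_eq_sum w hg1 hM1 hMlog, psiWeighted_sub_eq_sum w hh]
  have hrange : Finset.range M = Icc 0 ⌊x + h⌋₊ := by
    ext n; rw [Finset.mem_range, mem_Icc, hM]; omega
  rw [hrange]
  have hsub : Icc 0 ⌊x⌋₊ ⊆ Icc 0 ⌊x + h⌋₊ := Icc_subset_Icc le_rfl (Nat.floor_le_floor (by linarith))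
  rw [← Finset.sum_sdiff hsub]
  have hsd : Icc 0 ⌊x + h⌋₊ \ Icc 0 ⌊x⌋₊ = Finset.Ioc ⌊x⌋₊ ⌊x + h⌋₊ := by
    ext n; simp only [Finset.mem_sdiff, mem_Icc, Finset.mem_Ioc]; omega
  rw [hsd]
  have hzero : ∑ n ∈ Icc 0 ⌊x⌋₊, (∑ I ∈ idealsOfNorm K n, w I * idealVonMangoldt I) * g (Real.log n) = 0 := by
    refine Finset.sum_eq_zero fun n hn ↦ ?_
    rw [mem_Icc] at hn
    rw [hg0 _ (log_natCast_le_log_of_le_floor hx hn.2), mul_zero]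
  rw [hzero, add_zero]
  refine Finset.sum_le_sum fun n _ ↦ ?_
  have h01 := hg01 (Real.log n)
  have h0 := vonMangoldtWeighted_nonneg (K := K) hw n
  nlinarith [h01.2]

/-- **Upper unsmoothing**: if `g ≥ 0`, `g(u) = 1` for `log x < u ≤ log(x+h)` and `g = 0` on `[x₀, ∞)`
(`x ≥ 1`, `h ≥ 0`, `w ≥ 0`), then `ψ_w(x+h) − ψ_w(x) ≤ ψ̃_w(g)`. -/
theorem psiWeighted_sub_le_smoothedPsiWeighted (hw : ∀ I, 0 ≤ w I) {g : ℝ → ℝ} {x h x₀ : ℝ} (hx : 1 ≤ x)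
    (hh : 0 ≤ h) (hg0 : ∀ u, 0 ≤ g u)
    (hg1 : ∀ u, Real.log x < u → u ≤ Real.log (x + h) → g u = 1) (hgz : ∀ u, x₀ ≤ u → g u = 0) :
    (∑ n ∈ Icc 0 ⌊x + h⌋₊, ∑ I ∈ idealsOfNorm K n, w I * idealVonMangoldt I) -
        (∑ n ∈ Icc 0 ⌊x⌋₊, ∑ I ∈ idealsOfNorm K n, w I * idealVonMangoldt I) ≤
      (∑' n : ℕ, (∑ I ∈ idealsOfNorm K n, w I * idealVonMangoldt I) * g (Real.log n)) := by
  set M : ℕ := ⌊x + h⌋₊ + ⌈Real.exp x₀⌉₊ + 1 with hM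
  have hM1 : 1 ≤ M := by omega
  have hMpos : (0 : ℝ) < M := by exact_mod_cast hM1
  have hMlog : x₀ ≤ Real.log M := by
    rw [Real.le_log_iff_exp_le hMpos]
    have h1 : Real.exp x₀ ≤ ⌈Real.exp x₀⌉₊ := Nat.le_ceil _
    have h2 : (⌈Real.exp x₀⌉₊ : ℝ) ≤ M := by rw [hM]; push_cast; linarith [Nat.cast_nonneg (α := ℝ) ⌊x + h⌋₊]
    linarith
  rw [smoothedPsiWeighted_eq_sum w hgz hM1 hMlog, psiWeighted_sub_eq_sum w hh]
  have hsub : Finset.Ioc ⌊x⌋₊ ⌊x + h⌋₊ ⊆ Finset.range M := by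
    intro n hn
    rw [Finset.mem_Ioc] at hn
    rw [Finset.mem_range, hM]; omega
  calc ∑ n ∈ Finset.Ioc ⌊x⌋₊ ⌊x + h⌋₊, ∑ I ∈ idealsOfNorm K n, w I * idealVonMangoldt I
      = ∑ n ∈ Finset.Ioc ⌊x⌋₊ ⌊x + h⌋₊, (∑ I ∈ idealsOfNorm K n, w I * idealVonMangoldt I) * g (Real.log n) := by
        refine Finset.sum_congr rfl fun n hn ↦ ?_
        obtain ⟨h1, h2⟩ := log_natCast_mem_of_mem_Ioc hx hn
        rw [hg1 _ h1 h2, mul_one]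
    _ ≤ ∑ n ∈ Finset.range M, (∑ I ∈ idealsOfNorm K n, w I * idealVonMangoldt I) * g (Real.log n) :=
        Finset.sum_le_sum_of_subset_of_nonneg hsub fun n _ _ ↦
          mul_nonneg (vonMangoldtWeighted_nonneg hw n) (hg0 _)

end Unsmoothing

/-! ### Collar numerics -/

/-- `e^{y} − e^{z} ≤ (y − z) e^{y}` (convexity of the exponential). -/
theorem exp_sub_exp_le_mul (y z : ℝ) : Real.exp y - Real.exp z ≤ (y - z) * Real.exp y := by
  have h := Real.add_one_le_exp (z - y)
  have h2 : Real.exp (z - y) * Real.exp y = Real.exp z := by rw [← Real.exp_add]; ring_nf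
  nlinarith [Real.exp_pos y, Real.exp_pos (z - y)]

/-- **The collar of a window integral**: for `0 < σ ≤ 1`, `0 ≤ u ≤ v`:
`(e^{σv} − e^{σu})/σ ≤ (v − u) e^{v}`. -/
theorem exp_window_div_le {σ u v : ℝ} (hσ0 : 0 < σ) (hσ1 : σ ≤ 1) (hu : 0 ≤ u) (huv : u ≤ v) :
    (Real.exp (σ * v) - Real.exp (σ * u)) / σ ≤ (v - u) * Real.exp v := by
  have h1 : Real.exp (σ * v) - Real.exp (σ * u) ≤ (σ * v - σ * u) * Real.exp (σ * v) :=
    exp_sub_exp_le_mul _ _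
  have h2 : Real.exp (σ * v) ≤ Real.exp v := Real.exp_le_exp.2 (by nlinarith)
  rw [div_le_iff₀ hσ0]
  have hvu : 0 ≤ v - u := by linarith
  calc Real.exp (σ * v) - Real.exp (σ * u) ≤ (σ * v - σ * u) * Real.exp (σ * v) := h1
    _ = σ * ((v - u) * Real.exp (σ * v)) := by ring
    _ ≤ σ * ((v - u) * Real.exp v) :=
        mul_le_mul_of_nonneg_left (mul_le_mul_of_nonneg_left h2 hvu) hσ0.le
    _ = (v - u) * Real.exp v * σ := by ring

/-- The window integral in closed form: `∫_a^b e^{σu} du = (e^{σb} − e^{σa})/σ` (`σ ≠ 0`). -/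
theorem integral_exp_mul_eq {σ a b : ℝ} (hσ : σ ≠ 0) :
    (∫ u in a..b, Real.exp (σ * u)) = (Real.exp (σ * b) - Real.exp (σ * a)) / σ := by
  have h := intervalIntegral.integral_comp_mul_left (a := a) (b := b) Real.exp hσ
  rw [h, integral_exp, smul_eq_mul]
  field_simp

/-- **The two window integrals at `σ` differ from `(e^{σ b} − e^{σ a})/σ` by at most `2ε e^{b+ε}`**:
outer collar (`0 < σ ≤ 1`, `0 ≤ a − ε`, `a ≤ b`, `0 ≤ ε`). -/
theorem outer_collar_le {σ a b ε : ℝ} (hσ0 : 0 < σ) (hσ1 : σ ≤ 1) (ha : 0 ≤ a - ε) (hab : a ≤ b) (hε : 0 ≤ ε) :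
    (∫ u in (a - ε)..(b + ε), Real.exp (σ * u)) - (Real.exp (σ * b) - Real.exp (σ * a)) / σ ≤
      2 * ε * Real.exp (b + ε) := by
  rw [integral_exp_mul_eq hσ0.ne']
  have h1 := exp_window_div_le hσ0 hσ1 (by linarith : 0 ≤ b) (by linarith : b ≤ b + ε)
  have h2 := exp_window_div_le hσ0 hσ1 ha (by linarith : a - ε ≤ a)
  have h3 : Real.exp a ≤ Real.exp (b + ε) := Real.exp_le_exp.2 (by linarith)
  have e : (Real.exp (σ * (b + ε)) - Real.exp (σ * (a - ε))) / σ - (Real.exp (σ * b) - Real.exp (σ * a)) / σ =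
      (Real.exp (σ * (b + ε)) - Real.exp (σ * b)) / σ + (Real.exp (σ * a) - Real.exp (σ * (a - ε))) / σ := by
    field_simp; ring
  rw [e]
  have h4 : (b + ε - b) * Real.exp (b + ε) = ε * Real.exp (b + ε) := by ring
  have h5 : (a - (a - ε)) * Real.exp a = ε * Real.exp a := by ring
  rw [h4] at h1; rw [h5] at h2
  nlinarith

/-- **Inner collar**: `(e^{σb} − e^{σa})/σ − ∫_{a+ε}^{b−ε} e^{σu} du ≤ 2ε e^{b}` (`0 < σ ≤ 1`, `0 ≤ a`,
`a + ε ≤ b − ε`, `0 ≤ ε`). -/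
theorem inner_collar_le {σ a b ε : ℝ} (hσ0 : 0 < σ) (hσ1 : σ ≤ 1) (ha : 0 ≤ a) (hab : a + ε ≤ b - ε)
    (hε : 0 ≤ ε) :
    (Real.exp (σ * b) - Real.exp (σ * a)) / σ - (∫ u in (a + ε)..(b - ε), Real.exp (σ * u)) ≤
      2 * ε * Real.exp b := by
  rw [integral_exp_mul_eq hσ0.ne']
  have h1 := exp_window_div_le hσ0 hσ1 (by linarith : 0 ≤ b - ε) (by linarith : b - ε ≤ b)
  have h2 := exp_window_div_le hσ0 hσ1 ha (by linarith : a ≤ a + ε)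
  have h3 : Real.exp (a + ε) ≤ Real.exp b := Real.exp_le_exp.2 (by linarith)
  have e : (Real.exp (σ * b) - Real.exp (σ * a)) / σ - (Real.exp (σ * (b - ε)) - Real.exp (σ * (a + ε))) / σ =
      (Real.exp (σ * b) - Real.exp (σ * (b - ε))) / σ + (Real.exp (σ * (a + ε)) - Real.exp (σ * a)) / σ := by
    field_simp; ring
  rw [e]
  have h4 : (b - (b - ε)) * Real.exp b = ε * Real.exp b := by ring
  have h5 : (a + ε - a) * Real.exp (a + ε) = ε * Real.exp (a + ε) := by ring
  rw [h4] at h1; rw [h5] at h2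
  nlinarith

/-! ### The two-window sandwich -/

set_option maxHeartbeats 1600000 in
/-- **The two-window sandwich.**  For a weight `0 ≤ w` on the ideals of `K`, a multiplier `m ≥ 0`, a short
interval `(x, x+h]` (`1 < x`, `0 < h ≤ x`, `η = log(1 + h/x)`, so `log(x+h) = log x + η`, `xη ≤ h`), a collar
ratio `0 < ε₀ ≤ 1/4`, coefficients `|r_±| ≤ 1`, `1/2 ≤ σ ≤ 1`, and two-sided smoothed estimates for the upper
window `[log x, log x + η]` (coefficient `r₊`) and the lower window `[log x + ε, log x + η − ε]` (coefficient `r₋`,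
`ε = ε₀η`) with error `κ x η + J`: the unsmoothed difference `m(ψ_w(x+h) − ψ_w(x))` lies within
`κ h + 24ε₀ h + J` of `h − r_± (e^{σ(log x+η)} − e^{σ log x})/σ` (upper/lower). -/
theorem window_sandwich {K : Type} [Field K] [NumberField K] {w : Ideal (𝓞 K) → ℝ} (hw0 : ∀ I, 0 ≤ w I)
    {m : ℝ} (hm0 : 0 ≤ m) {x h η ε₀ κ J : ℝ} (hx1 : 1 < x) (hh0 : 0 < h) (hhx : h ≤ x) (hη0 : 0 < η)
    (hlogxh : Real.log (x + h) = Real.log x + η) (hxη : x * η ≤ h) (hexpη : Real.exp (Real.log x + η) = x + h)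
    (hε₀0 : 0 < ε₀) (hε₀1 : ε₀ ≤ 1 / 4) (h2ε : 2 * (ε₀ * η) < η) (hL16 : 2 ≤ Real.log x) (hκ4 : 0 < κ)
    {rU rD σ : ℝ} (hrU : |rU| ≤ 1) (hrD : |rD| ≤ 1) (hσ : 1 / 2 ≤ σ) (hσ1 : σ ≤ 1)
    (hup : m * (∑' k : ℕ, (∑ I ∈ idealsOfNorm K k, w I * idealVonMangoldt I) *
              windowTest (Real.log x) (Real.log x + η) (ε₀ * η) (Real.log k)) ≤
            (fordLaplace (windowTest (Real.log x) (Real.log x + η) (ε₀ * η)) (-1)).re -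
              rU * (fordLaplace (windowTest (Real.log x) (Real.log x + η) (ε₀ * η)) (-(σ : ℂ))).re +
              (κ * x * η + J))
    (hlow : (fordLaplace (windowTest (Real.log x + ε₀ * η) (Real.log x + η - ε₀ * η) (ε₀ * η)) (-1)).re -
              rD * (fordLaplace (windowTest (Real.log x + ε₀ * η) (Real.log x + η - ε₀ * η) (ε₀ * η)) (-(σ : ℂ))).re -
              (κ * x * η + J) ≤
            m * (∑' k : ℕ, (∑ I ∈ idealsOfNorm K k, w I * idealVonMangoldt I) *
              windowTest (Real.log x + ε₀ * η) (Real.log x + η - ε₀ * η) (ε₀ * η) (Real.log k))) :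
    m * ((∑ n ∈ Icc 0 ⌊x + h⌋₊, ∑ I ∈ idealsOfNorm K n, w I * idealVonMangoldt I) -
        (∑ n ∈ Icc 0 ⌊x⌋₊, ∑ I ∈ idealsOfNorm K n, w I * idealVonMangoldt I)) ≤
      h - rU * ((Real.exp (σ * (Real.log x + η)) - Real.exp (σ * Real.log x)) / σ) +
        (κ * h + 24 * ε₀ * h + J) ∧
    h - rD * ((Real.exp (σ * (Real.log x + η)) - Real.exp (σ * Real.log x)) / σ) -
        (κ * h + 24 * ε₀ * h + J) ≤
      m * ((∑ n ∈ Icc 0 ⌊x + h⌋₊, ∑ I ∈ idealsOfNorm K n, w I * idealVonMangoldt I) -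
        (∑ n ∈ Icc 0 ⌊x⌋₊, ∑ I ∈ idealsOfNorm K n, w I * idealVonMangoldt I)) := by
  have hx0 : 0 < x := by linarith
  set L : ℝ := Real.log x with hL
  set ε : ℝ := ε₀ * η with hε
  have hε0 : 0 < ε := by positivity
  have hη1' : η ≤ 1 := by
    have h1 : x * η ≤ x * 1 := by linarith
    exact le_of_mul_le_mul_left h1 hx0
  have hε1 : ε ≤ 1 := by
    rw [hε]; have := mul_le_mul hε₀1 hη1' hη0.le (by norm_num); linarith
  have hexpL : Real.exp L = x := by rw [hL, Real.exp_log hx0]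
  have hσ0 : 0 < σ := by linarith
  have he3 : Real.exp ε ≤ 3 := by
    have := Real.exp_one_lt_d9
    have := Real.exp_le_exp.2 hε1; linarith
  set I₀ : ℝ := (Real.exp (σ * (L + η)) - Real.exp (σ * L)) / σ with hI₀
  -- UPPER window
  set gU := windowTest L (L + η) ε with hgU
  have hU : (∑ n ∈ Icc 0 ⌊x + h⌋₊, ∑ I ∈ idealsOfNorm K n, w I * idealVonMangoldt I) -
      (∑ n ∈ Icc 0 ⌊x⌋₊, ∑ I ∈ idealsOfNorm K n, w I * idealVonMangoldt I) ≤
      (∑' k : ℕ, (∑ I ∈ idealsOfNorm K k, w I * idealVonMangoldt I) * gU (Real.log k)) := by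
    refine psiWeighted_sub_le_smoothedPsiWeighted hw0 (x₀ := L + η + ε) hx1.le hh0.le
      (fun u ↦ windowTest_nonneg _ _ _ u) (fun u hu1 hu2 ↦ ?_) (fun u hu ↦ windowTest_eq_zero_of_ge hε0 hu)
    have hu2' : u ≤ L + η := by rw [← hlogxh]; exact hu2
    exact windowTest_eq_one hε0 hu1.le hu2'
  have hF1up := (fordLaplace_windowTest_neg_one_mem (a := L) (b := L + η) hε0 (by linarith) (by linarith)).2
  have hFσup := (fordLaplace_windowTest_real_mem (a := L) (b := L + η) hε0 (by linarith) (by linarith) σ).2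
  have hFσup' := (fordLaplace_windowTest_real_mem (a := L) (b := L + η) hε0 (by linarith) (by linarith) σ).1
  have hexp3 : 2 * ε * Real.exp (L + η + ε) ≤ 2 * ε * (3 * (x + h)) := by
    have h2 : Real.exp (L + η + ε) = (x + h) * Real.exp ε := by rw [Real.exp_add, hexpη]
    rw [h2]; refine mul_le_mul_of_nonneg_left ?_ (by positivity); nlinarith
  have hcol1 : Real.exp (L + η + ε) - Real.exp (L - ε) ≤ h + 2 * ε * (3 * (x + h)) := by
    have h1 := outer_collar_le (σ := 1) one_pos le_rfl (a := L) (b := L + η) (ε := ε) (by linarith) (by linarith) hε0.le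
    simp only [one_mul, div_one] at h1
    rw [integral_exp, hexpη, hexpL] at h1
    linarith
  have hcolσ : (∫ u in (L - ε)..(L + η + ε), Real.exp (σ * u)) ≤ I₀ + 2 * ε * (3 * (x + h)) := by
    have h1 := outer_collar_le hσ0 hσ1 (a := L) (b := L + η) (ε := ε) (by linarith) (by linarith) hε0.le
    rw [← hI₀] at h1
    linarith
  have hI₀lo : I₀ ≤ (fordLaplace gU (-(σ : ℂ))).re := by
    rw [hI₀, ← integral_exp_mul_eq hσ0.ne']; exact hFσup'
  have hFσup2 : (fordLaplace gU (-(σ : ℂ))).re ≤ I₀ + 2 * ε * (3 * (x + h)) := hFσup.trans hcolσ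
  -- LOWER window
  set gD := windowTest (L + ε) (L + η - ε) ε with hgD
  have hD : (∑' k : ℕ, (∑ I ∈ idealsOfNorm K k, w I * idealVonMangoldt I) * gD (Real.log k)) ≤
      (∑ n ∈ Icc 0 ⌊x + h⌋₊, ∑ I ∈ idealsOfNorm K n, w I * idealVonMangoldt I) -
        (∑ n ∈ Icc 0 ⌊x⌋₊, ∑ I ∈ idealsOfNorm K n, w I * idealVonMangoldt I) := by
    refine smoothedPsiWeighted_le_psiWeighted_sub hw0 hx1.le hh0.le (fun u ↦ windowTest_mem_Icc _ _ _ u)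
      (fun u hu ↦ windowTest_eq_zero_of_le hε0 (by have : u ≤ L := hu; linarith)) (fun u hu ↦ ?_)
    refine windowTest_eq_zero_of_ge hε0 ?_
    have hu' : L + η ≤ u := by rw [← hlogxh]; exact hu
    linarith
  have hF1lo := (fordLaplace_windowTest_neg_one_mem (a := L + ε) (b := L + η - ε) hε0 (by linarith) (by linarith)).1
  have hFσlo := (fordLaplace_windowTest_real_mem (a := L + ε) (b := L + η - ε) hε0 (by linarith) (by linarith) σ).1
  have hFσlo' := (fordLaplace_windowTest_real_mem (a := L + ε) (b := L + η - ε) hε0 (by linarith) (by linarith) σ).2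
  have hcol2 : h - 2 * ε * (x + h) ≤ Real.exp (L + η - ε) - Real.exp (L + ε) := by
    have h1 := inner_collar_le (σ := 1) one_pos le_rfl (a := L) (b := L + η) (ε := ε) (by linarith) (by linarith) hε0.le
    simp only [one_mul, div_one] at h1
    rw [integral_exp, hexpη, hexpL] at h1
    linarith
  have hcolσ2 : I₀ - 2 * ε * (x + h) ≤ (∫ u in (L + ε)..(L + η - ε), Real.exp (σ * u)) := by
    have h1 := inner_collar_le hσ0 hσ1 (a := L) (b := L + η) (ε := ε) (by linarith) (by linarith) hε0.le
    rw [← hI₀, hexpη] at h1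
    linarith
  have hI₀hi : (fordLaplace gD (-(σ : ℂ))).re ≤ I₀ := by
    have e1 : L + ε - ε = L := by ring
    have e2 : (L + η - ε) + ε = L + η := by ring
    refine hFσlo'.trans (le_of_eq ?_)
    rw [e1, e2, integral_exp_mul_eq hσ0.ne', hI₀]
  have hFσlo2 : I₀ - 2 * ε * (x + h) ≤ (fordLaplace gD (-(σ : ℂ))).re := hcolσ2.trans hFσlo
  -- numerics
  have hrU1 := abs_le.1 hrU
  have hrD1 := abs_le.1 hrD
  have hεxh : ε * (x + h) ≤ 2 * ε₀ * h := by
    have : x + h ≤ 2 * x := by linarith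
    have h2 : ε * (x + h) ≤ ε₀ * η * (2 * x) := by rw [hε]; exact mul_le_mul_of_nonneg_left this (by positivity)
    have h3 : ε₀ * η * (2 * x) = 2 * ε₀ * (x * η) := by ring
    have h4 : 2 * ε₀ * (x * η) ≤ 2 * ε₀ * h := mul_le_mul_of_nonneg_left hxη (by positivity)
    linarith
  have hκxη : κ * x * η ≤ κ * h := by
    have := mul_le_mul_of_nonneg_left hxη hκ4.le; linarith
  have hmU := mul_le_mul_of_nonneg_left hU hm0
  have hmD := mul_le_mul_of_nonneg_left hD hm0
  have hI₀0 : 0 ≤ I₀ := by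
    rw [hI₀]; refine div_nonneg ?_ hσ0.le
    have hle : σ * L ≤ σ * (L + η) := mul_le_mul_of_nonneg_left (by linarith) hσ0.le
    have := Real.exp_le_exp.2 hle; linarith
  have hcol0 : 0 ≤ 2 * ε * (3 * (x + h)) := by positivity
  have hrU : -(rU * (fordLaplace gU (-(σ : ℂ))).re) ≤ -(rU * I₀) + 2 * ε * (3 * (x + h)) := by
    rcases le_or_gt 0 rU with hr0 | hr0
    · have h1 := mul_le_mul_of_nonneg_left hI₀lo hr0
      linarith
    · have h1 := mul_le_mul_of_nonneg_left hFσup2 (by linarith : 0 ≤ -rU)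
      have h2 : -rU * (2 * ε * (3 * (x + h))) ≤ 1 * (2 * ε * (3 * (x + h))) :=
        mul_le_mul_of_nonneg_right (by linarith [hrU1.1]) hcol0
      linarith
  have hrD : -(rD * I₀) - 2 * ε * (3 * (x + h)) ≤ -(rD * (fordLaplace gD (-(σ : ℂ))).re) := by
    have hcol0' : 0 ≤ 2 * ε * (x + h) := by positivity
    rcases le_or_gt 0 rD with hr0 | hr0
    · have h1 := mul_le_mul_of_nonneg_left hI₀hi hr0
      linarith
    · have h1 := mul_le_mul_of_nonneg_left hFσlo2 (by linarith : 0 ≤ -rD)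
      have h3 : (-1) * (2 * ε * (x + h)) ≤ rD * (2 * ε * (x + h)) := mul_le_mul_of_nonneg_right hrD1.1 hcol0'
      have h4 : (-rD) * (I₀ - 2 * ε * (x + h)) = -(rD * I₀) + rD * (2 * ε * (x + h)) := by ring
      linarith
  constructor
  · linarith [hmU, hup, hF1up, hcol1, hrU, hεxh, hκxη]
  · linarith [hmD, hlow, hF1lo, hcol2, hrD, hεxh, hκxη]

end Summit.QuantumAdvantage.QuantumAdvantage.Theorems.DegreeOnePrimesEscape

end
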